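import Mathlib.GroupTheory.Complement
import Summits.MatrixMultiplication.OmegaCensus.BoxBadCommutingPairs

/-!
# ω-census, family (b3): conjecture C9 (b) — the second class-`3` configuration (non-central involution commutator) gives box ratio `≥ 2`

HONEST FRAMING (pub-omega census; verbatim): lottery ticket; floor = certified bounds/negative ranges.
Census BOOKKEEPING (conjecture C9 of the cell, STRUCTURE.md §2; pub-omega kernel-l4 gen 15, task K-4 = the `p = 2` side of
`BoxBadOddPGroups`).  CLASS-`3` minimal bad `2`-groups of configuration (B): `c = h g h⁻¹ g⁻¹` is an INVOLUTION commuting with `g`, not central,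
with `c h c⁻¹ h⁻¹ = z` a central involution (SmallGroup(64, 25), (64, 30); (128, 110), (128, 132); the order-`32` class-`3` groups
with `G′ = C₂²`).  Settled UNIFORMLY, like configuration (A) (`BoxBadClass3A`) and types I / II-a / II-b:

**Theorem (`exists_indep_class3B`).** Under these relations the box `G × {1, g⁻¹, h⁻¹} × {1, g⁻¹, h²}` carries `≥ 2|G|` independent cells:
eight parts `(u k, y, w)` with `k` in a transversal of `N = {1, c, z, zc}` and `(u, y, w)` = `(1,1,1)`, `(gz,1,g⁻¹)`, `(h⁻²z,1,h²)`,
`(gzc,g⁻¹,1)`, `(g²c,g⁻¹,g⁻¹)`, `(hzc,h⁻¹,1)`, `(ghz,h⁻¹,g⁻¹)`, `(h⁻¹c,h⁻¹,h²)`; the `64` word equations close under one simp normal form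
(sort `g`-letters left of `h`-letters, front `c` then `z`; `h c = z c h`, `h⁻¹ c = z c h⁻¹`).  Found from the seat's data (universal
`36`-vertex key graph, `q36e.py`; numerics `verifyIIIB.py`).  **Corollary (`not_boxUseful_of_class3B`).**  With `BoxBadClass3A` and the
class-`2` files every minimal bad `2`-group configuration found by the census (orders `≤ 128`) is covered by a uniform theorem.
Nothing here is progress on `ω`.
-/

namespace Summit.MatrixMultiplication.OmegaCensus

open Finset ProductBoxBound

namespace CommPairs

variable {G : Type*} [Group G]

set_option maxHeartbeats 4000000 in
/-- **The uniform ratio-`2` witness for the class-`3` configuration with an involution commutator.** [folklore] -/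
theorem exists_indep_class3B [Fintype G] [DecidableEq G] {g h c z : G} (hc : h * g * h⁻¹ * g⁻¹ = c) (hcg : c * g = g * c)
    (hch : c * h * c⁻¹ * h⁻¹ = z) (hz : z ∈ Subgroup.center G) (hcc : c * c = 1) (hz1 : z ≠ 1) (hzz : z * z = 1) :
    ∃ (Y W : Finset G) (J : Finset (G × G × G)), #Y = 3 ∧ #W = 3 ∧ J ⊆ univ ×ˢ (Y ×ˢ W) ∧
      (∀ P ∈ J, ∀ P' ∈ J, P ≠ P' → cellWord P P' ≠ 1) ∧ 2 * Fintype.card G ≤ #J := by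
  classical
  -- centrality of `z` and normalisation rules
  have zc' : ∀ t : G, t * z = z * t := fun t => Subgroup.mem_center_iff.mp hz t
  have zl : ∀ x t : G, x * (z * t) = z * (x * t) := fun x t => by rw [← mul_assoc, zc' x, mul_assoc]
  have q2 : ∀ t : G, z * (z * t) = t := fun t => by rw [← mul_assoc, hzz, one_mul]
  have c2 : ∀ t : G, c * (c * t) = t := fun t => by rw [← mul_assoc, hcc, one_mul]
  have i1 : c⁻¹ = c := by rw [inv_eq_iff_mul_eq_one, hcc]
  have iz : z⁻¹ = z := by rw [inv_eq_iff_mul_eq_one, hzz]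
  have A1 : h * g = c * (g * h) := by
    calc h * g = h * g * h⁻¹ * g⁻¹ * (g * h) := by group
      _ = c * (g * h) := by rw [hc]
  have A2 : c * h = z * (h * c) := by
    calc c * h = c * h * c⁻¹ * h⁻¹ * (h * c) := by group
      _ = z * (h * c) := by rw [hch]
  have Cg : ∀ t : G, g * (c * t) = c * (g * t) := fun t => by rw [← mul_assoc, ← hcg, mul_assoc]
  have Cgi : ∀ t : G, g⁻¹ * (c * t) = c * (g⁻¹ * t) := fun t => by
    have : g⁻¹ * c = c * g⁻¹ := by
      calc g⁻¹ * c = g⁻¹ * (c * g) * g⁻¹ := by group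
        _ = g⁻¹ * (g * c) * g⁻¹ := by rw [hcg]
        _ = c * g⁻¹ := by group
    rw [← mul_assoc, this, mul_assoc]
  have Ch : ∀ t : G, h * (c * t) = z * (c * (h * t)) := fun t => by
    have : h * c = z * (c * h) := by
      calc h * c = z * (z * (h * c)) := (q2 _).symm
        _ = z * (c * h) := by rw [← A2]
    rw [← mul_assoc, this]; simp only [mul_assoc]
  have Chi : ∀ t : G, h⁻¹ * (c * t) = z * (c * (h⁻¹ * t)) := fun t => by
    have : h⁻¹ * c = z * (c * h⁻¹) := by
      calc h⁻¹ * c = h⁻¹ * (c * h) * h⁻¹ := by group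
        _ = h⁻¹ * (z * (h * c)) * h⁻¹ := by rw [A2]
        _ = z * (h⁻¹ * (h * c)) * h⁻¹ := by rw [zl]
        _ = z * (c * h⁻¹) := by group
    rw [← mul_assoc, this]; simp only [mul_assoc]
  -- sorting rules (`g`-letters move left past `h`-letters)
  have gic : g⁻¹ * c = c * g⁻¹ := by
    calc g⁻¹ * c = g⁻¹ * (c * g) * g⁻¹ := by group
      _ = g⁻¹ * (g * c) * g⁻¹ := by rw [hcg]
      _ = c * g⁻¹ := by group
  have gici : g⁻¹ * c⁻¹ = c⁻¹ * g⁻¹ := by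
    calc g⁻¹ * c⁻¹ = (c * g)⁻¹ := by group
      _ = (g * c)⁻¹ := by rw [hcg]
      _ = c⁻¹ * g⁻¹ := by group
  have hic : h⁻¹ * c = z * (c * h⁻¹) := by simpa using Chi 1
  have F : g * h = c⁻¹ * (h * g) := by rw [A1, ← mul_assoc, inv_mul_cancel, one_mul]
  have S1 : ∀ t : G, h * (g * t) = c * (g * (h * t)) := fun t => by rw [← mul_assoc, A1]; simp only [mul_assoc]
  have S2 : ∀ t : G, h * (g⁻¹ * t) = c⁻¹ * (g⁻¹ * (h * t)) := fun t => by
    have B : h * g⁻¹ = c⁻¹ * (g⁻¹ * h) := by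
      calc h * g⁻¹ = g⁻¹ * (g * h) * g⁻¹ := by group
        _ = g⁻¹ * (c⁻¹ * (h * g)) * g⁻¹ := by rw [F]
        _ = (g⁻¹ * c⁻¹) * h := by group
        _ = (c⁻¹ * g⁻¹) * h := by rw [gici]
        _ = c⁻¹ * (g⁻¹ * h) := by group
    rw [← mul_assoc, B]; simp only [mul_assoc]
  have S3 : ∀ t : G, h⁻¹ * (g * t) = z * (c * (g * (h⁻¹ * t))) := fun t => by
    have E : g * h⁻¹ = h⁻¹ * (c * g) := by
      calc g * h⁻¹ = h⁻¹ * (h * g) * h⁻¹ := by group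
        _ = h⁻¹ * (c * (g * h)) * h⁻¹ := by rw [A1]
        _ = h⁻¹ * (c * g) := by group
    have E2 : g * h⁻¹ = z * (c * (h⁻¹ * g)) := by rw [E, Chi]
    have B : h⁻¹ * g = z * (c * (g * h⁻¹)) := by
      calc h⁻¹ * g = c⁻¹ * (z * (z * (c * (h⁻¹ * g)))) := by rw [q2, ← mul_assoc, inv_mul_cancel, one_mul]
        _ = c⁻¹ * (z * (g * h⁻¹)) := by rw [← E2]
        _ = c * (z * (g * h⁻¹)) := by rw [i1]
        _ = z * (c * (g * h⁻¹)) := by rw [zl]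
    rw [← mul_assoc, B]; simp only [mul_assoc]
  have S4 : ∀ t : G, h⁻¹ * (g⁻¹ * t) = z * (c * (g⁻¹ * (h⁻¹ * t))) := fun t => by
    have B : h⁻¹ * g⁻¹ = z * (c * (g⁻¹ * h⁻¹)) := by
      calc h⁻¹ * g⁻¹ = (g * h)⁻¹ := by group
        _ = (c⁻¹ * (h * g))⁻¹ := by rw [F]
        _ = g⁻¹ * (h⁻¹ * c) := by group
        _ = g⁻¹ * (z * (c * h⁻¹)) := by rw [hic]
        _ = z * ((g⁻¹ * c) * h⁻¹) := by rw [zl]; group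
        _ = z * ((c * g⁻¹) * h⁻¹) := by rw [gic]
        _ = z * (c * (g⁻¹ * h⁻¹)) := by group
    rw [← mul_assoc, B]; simp only [mul_assoc]
  -- the commutator of `h²` with `g`
  have A3 : (h * h) * g * (h * h)⁻¹ * g⁻¹ = z := by
    have e2 : h * g * h⁻¹ = c * g := by rw [← hc]; group
    have e3 : h * c * h⁻¹ = z * c := by
      calc h * c * h⁻¹ = z * (z * (h * c)) * h⁻¹ := by rw [q2]
        _ = z * (c * h) * h⁻¹ := by rw [← A2]
        _ = z * c := by group
    calc (h * h) * g * (h * h)⁻¹ * g⁻¹ = h * (h * g * h⁻¹) * h⁻¹ * g⁻¹ := by group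
      _ = h * (c * g) * h⁻¹ * g⁻¹ := by rw [e2]
      _ = (h * c * h⁻¹) * (h * g * h⁻¹) * g⁻¹ := by group
      _ = (z * c) * (c * g) * g⁻¹ := by rw [e3, e2]
      _ = z * (c * (c * (g * g⁻¹))) := by group
      _ = z := by rw [c2, mul_inv_cancel, mul_one]
  -- distinctness
  have hc1 : c ≠ 1 := by rintro rfl; apply hz1; rw [← hch]; group
  have hg1 : g ≠ 1 := by rintro rfl; apply hc1; rw [← hc]; group
  have hh1 : h ≠ 1 := by rintro rfl; apply hc1; rw [← hc]; group
  have hgh' : g ≠ h := by rintro rfl; apply hc1; rw [← hc]; group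
  have hhh : h * h ≠ 1 := by intro e; apply hz1; rw [← A3, e]; group
  have hhhg : h * h ≠ g⁻¹ := by
    intro e; apply hc1; rw [← hc]
    have : g = (h * h)⁻¹ := by rw [e, inv_inv]
    rw [this]; group
  have hgi1 : g⁻¹ ≠ 1 := fun e => hg1 (inv_eq_one.mp e)
  have hhi1 : h⁻¹ ≠ 1 := fun e => hh1 (inv_eq_one.mp e)
  have hgihi : g⁻¹ ≠ h⁻¹ := fun e => hgh' (inv_injective e)
  -- the subgroup `N = {1, c, z, zc}` and a transversal
  have hzc1 : z * c ≠ 1 := by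
    intro e; apply hz1
    have ecz : c = z := by
      calc c = z * (z * c) := (q2 c).symm
        _ = z := by rw [e, mul_one]
    calc z = c * h * c⁻¹ * h⁻¹ := hch.symm
      _ = z * h * z⁻¹ * h⁻¹ := by rw [ecz]
      _ = z * (h * z) * h⁻¹ := by rw [iz]; group
      _ = z * (z * h) * h⁻¹ := by rw [zc' h]
      _ = z * z := by group
      _ = 1 := hzz
  have czc : c * z = z * c := zc' c
  let S : Finset G := {1, c, z, z * c}
  have memS : ∀ x : G, x ∈ S ↔ x = 1 ∨ x = c ∨ x = z ∨ x = z * c := fun x => by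
    simp only [S, Finset.mem_insert, Finset.mem_singleton]
  let N : Subgroup G :=
    { carrier := ↑S
      mul_mem' := by
        intro a b ha hb
        rw [Finset.mem_coe, memS] at ha hb ⊢
        rcases ha with ha | ha | ha | ha <;> rcases hb with hb | hb | hb | hb <;> rw [ha, hb] <;>
          simp [hcc, hzz, czc, mul_assoc, q2, zl c]
      one_mem' := by rw [Finset.mem_coe, memS]; exact Or.inl rfl
      inv_mem' := by
        intro a ha
        rw [Finset.mem_coe, memS] at ha ⊢
        rcases ha with ha | ha | ha | ha <;> rw [ha]
        · exact Or.inl inv_one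
        · exact Or.inr (Or.inl i1)
        · exact Or.inr (Or.inr (Or.inl iz))
        · right; right; right; rw [mul_inv_rev, i1, iz, czc] }
  have memN : ∀ x : G, x ∈ N ↔ x = 1 ∨ x = c ∨ x = z ∨ x = z * c := fun x => by
    rw [← memS]; exact Iff.rfl
  have cardN : Nat.card N ≤ 4 := by
    have : Nat.card N = Nat.card (↑S : Set G) := rfl
    rw [this, Nat.card_coe_set_eq, Set.ncard_coe_finset]
    exact (Finset.card_insert_le _ _).trans (Nat.succ_le_succ ((Finset.card_insert_le _ _).trans
      (Nat.succ_le_succ ((Finset.card_insert_le _ _).trans (Nat.succ_le_succ (Finset.card_singleton _).le)))))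
  obtain ⟨Rset, hR, -⟩ := N.exists_isComplement_right 1
  have hRfin : Rset.Finite := Set.toFinite Rset
  set K : Finset G := hRfin.toFinset with hKdef
  have memK : ∀ r, r ∈ K ↔ r ∈ Rset := fun r => Set.Finite.mem_toFinset hRfin
  have cardK : Fintype.card G ≤ 4 * #K := by
    have e1 : #K = N.index := by rw [hKdef, ← hR.ncard_right, Set.ncard_eq_toFinset_card Rset hRfin]
    have e2 : Nat.card N * N.index = Nat.card G := N.card_mul_index
    rw [← Nat.card_eq_fintype_card, ← e2, e1]
    exact Nat.mul_le_mul_right _ cardN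
  have noN : ∀ n : G, n ∈ N → n ≠ 1 → ∀ b ∈ K, ∀ b' ∈ K, n * b ≠ b' := by
    intro n hn hn1 b hb b' hb' e
    have := @hR.1 (⟨n, hn⟩, ⟨b, (memK b).1 hb⟩) (⟨1, N.one_mem⟩, ⟨b', (memK b').1 hb'⟩) (by simpa using e)
    simp only [Prod.mk.injEq, Subtype.mk.injEq] at this
    exact hn1 this.1
  have no1 : ∀ b ∈ K, ∀ b' ∈ K, c * b ≠ b' := noN c ((memN _).2 (Or.inr (Or.inl rfl))) hc1
  have noz : ∀ b ∈ K, ∀ b' ∈ K, z * b ≠ b' := noN z ((memN _).2 (Or.inr (Or.inr (Or.inl rfl)))) hz1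
  have nozc : ∀ b ∈ K, ∀ b' ∈ K, z * (c * b) ≠ b' := fun b hb b' hb' e =>
    noN (z * c) ((memN _).2 (Or.inr (Or.inr (Or.inr rfl)))) hzc1 b hb b' hb' (by rw [mul_assoc]; exact e)
  -- the eight parts, indexed by `Fin 8`
  let U : Fin 8 → G × G × G := fun i => match i with
    | ⟨0, _⟩ => (1, 1, 1)
    | ⟨1, _⟩ => (g * z, 1, g⁻¹)
    | ⟨2, _⟩ => (h⁻¹ * h⁻¹ * z, 1, h * h)
    | ⟨3, _⟩ => (g * (z * c), g⁻¹, 1)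
    | ⟨4, _⟩ => (g * g * c, g⁻¹, g⁻¹)
    | ⟨5, _⟩ => (h * (z * c), h⁻¹, 1)
    | ⟨6, _⟩ => (g * h * z, h⁻¹, g⁻¹)
    | ⟨7, _⟩ => (h⁻¹ * c, h⁻¹, h * h)
    | ⟨n + 8, hn⟩ => absurd hn (by omega)
  let f : G × Fin 8 → G × G × G := fun p => ((U p.2).1 * p.1, (U p.2).2.1, (U p.2).2.2)
  have finj : Set.InjOn f ↑(K ×ˢ (Finset.univ : Finset (Fin 8))) := by
    rintro ⟨k, i⟩ - ⟨k', i'⟩ - e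
    have e23 : (U i).2 = (U i').2 := by
      have h2 := congrArg (fun P : G × G × G => P.2) e
      simpa [f] using h2
    have hii : i = i' := by
      fin_cases i <;> fin_cases i' <;>
        simp [U, hgi1, hhi1, hgihi, hhh, hhhg, hgi1.symm, hhi1.symm, hgihi.symm, hhh.symm, hhhg.symm] at e23 ⊢
    subst hii
    have e1 : (U i).1 * k = (U i).1 * k' := congrArg Prod.fst e
    rw [mul_left_cancel e1]
  set J : Finset (G × G × G) := (K ×ˢ (Finset.univ : Finset (Fin 8))).image f with hJ
  have cardJ : #J = #K * 8 := by
    rw [hJ, Finset.card_image_of_injOn finj, Finset.card_product, Finset.card_univ, Fintype.card_fin]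
  have memJ : ∀ {P : G × G × G}, P ∈ J → ∃ k ∈ K, ∃ i : Fin 8, P = ((U i).1 * k, (U i).2.1, (U i).2.2) := by
    intro P hP
    obtain ⟨⟨k, i⟩, hki, rfl⟩ := Finset.mem_image.1 hP
    exact ⟨k, (Finset.mem_product.1 hki).1, i, rfl⟩
  refine ⟨{1, g⁻¹, h⁻¹}, {1, g⁻¹, h * h}, J, ?_, ?_, ?_, ?_, ?_⟩
  · rw [card_insert_of_notMem (by simp [hgi1.symm, hhi1.symm]), card_insert_of_notMem (by simpa using hgihi), card_singleton]
  · rw [card_insert_of_notMem (by simp [hgi1.symm, hhh.symm]), card_insert_of_notMem (by simpa using fun e => hhhg e.symm),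
      card_singleton]
  · intro P hP
    obtain ⟨k, -, i, rfl⟩ := memJ hP
    simp only [mem_product, mem_univ, true_and, mem_insert, mem_singleton]
    fin_cases i <;> simp [U]
  · -- independence: 64 cases, one normalisation
    intro P hP P' hP' hne hw
    obtain ⟨k, hk, i, rfl⟩ := memJ hP
    obtain ⟨k', hk', i', rfl⟩ := memJ hP'
    fin_cases i <;> fin_cases i' <;> simp only [U, cellWord] at hw hne <;> have e := solve_left hw <;>
      simp only [mul_assoc, mul_inv_rev, inv_inv, inv_one, one_mul, mul_one, S1, S2, S3, S4, i1, iz, c2, q2, Cg, Cgi, Ch, Chi,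
        zl g, zl g⁻¹, zl h, zl h⁻¹, zl c, mul_inv_cancel_left, inv_mul_cancel_left] at e <;>
      first
        | exact (no1 k' hk' k hk e.symm).elim
        | exact (noz k' hk' k hk e.symm).elim
        | exact (nozc k' hk' k hk e.symm).elim
        | (apply hne; rw [e])
  · rw [cardJ]; omega

/-- **A finite group with the involution-commutator class-`3` configuration is NOT box-useful.** [folklore] -/
theorem not_boxUseful_of_class3B [Fintype G] [DecidableEq G] {g h c z : G} (hc : h * g * h⁻¹ * g⁻¹ = c) (hcg : c * g = g * c)
    (hch : c * h * c⁻¹ * h⁻¹ = z) (hz : z ∈ Subgroup.center G) (hcc : c * c = 1) (hz1 : z ≠ 1) (hzz : z * z = 1) :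
    ¬ BoxUseful G := by
  obtain ⟨Y, W, J, hY, hW, hJ, hind, hcard⟩ := exists_indep_class3B hc hcg hch hz hcc hz1 hzz
  exact not_boxUseful_of_indep hY hW hJ hind (by omega)

end CommPairs

end Summit.MatrixMultiplication.OmegaCensus
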